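import Literature.NumberTheory.EllipticCurves.LeadingTermPPartEisensteinProofs
import Literature.NumberTheory.EllipticCurves.Rank1Residual.PrintShapeTorsion
import Literature.NumberTheory.EllipticCurves.Rank1Residual.Predicates
import HarnessLib

/-!
# Greenberg–Vatsal, *On the Iwasawa invariants of elliptic curves* (Invent. Math. 142 (2000)):
# Thm. 1.3 + (1.2) ⇒ Mazur's (MC) at an Eisenstein prime under the parity condition (GV)

HONEST FRAMING (cell `b2b-bsdres`, home `run/shared/lean/b2b/bsd-rank1-residual/`): the cell deletes
COMBINATION-SHAPED residual classes of the rank-`≤ 1` BSD formula from PUBLISHED theorems only and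
types the rest; this is not "finishing BSD". This statement file vendors ONE published theorem as a
named fact (D-0014), in the tree's vocabulary, and records its rank-`0` consequence:

* `thm13_charIdeal_eq_of_gvPar` (NAMED FACT, PUB): R. Greenberg, V. Vatsal, Invent. Math. 142
  (2000) 17–63, Theorem (1.3) (arXiv:math/9906215, pp. 4–5): "Assume that `E` is a modular elliptic
  curve over `ℚ`, and that `p` is an odd prime where `E` has good ordinary reduction. Assume also that
  `E` admits a `ℚ`-isogeny of degree `p` with kernel `Φ`, and that the action of `G_ℚ` on `Φ` is
  either ramified at `p` and even, or unramified at `p` and odd. Then `λ_alg(E) = λ_anal(E)` and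
  `μ_alg(E) = μ_anal(E) = 0`", together with Theorem (1.2) (Kato: "The polynomial `f_alg,E(T)` divides
  `f_anal,E(T)` in `ℚ_p[T]`") and the sentence following it (p. 4): "As a consequence, it is clear
  that the equality `λ_alg = λ_anal` implies that `f_alg,E(T)` and `f_anal,E(T)` differ by
  multiplication by a power of `p`. The further equality `μ_alg = μ_anal` then implies the Main
  Conjecture" — i.e. Conjecture (1.1) (Mazur): `f_alg,E(T) = f_anal,E(T)`, where (pp. 2–4)
  `f_alg,E` is the characteristic polynomial of `X_E(ℚ_∞) = Sel_E(ℚ_∞)_p^∨` and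
  `L(E/ℚ,T) = p^{μ_anal} u(T) f_anal-part` with `u ∈ Λ^×` is the `p`-adic `L`-function built with
  "the real Néron period `Ω_E`" (p. 3). Hence, under (GV), `char_Λ X_E(ℚ_∞) = (L(E/ℚ,T))` as ideals
  of `Λ` — Mazur's (MC) for `(E,p)` in the Néron normalisation, transcribed EXACTLY as the hypothesis
  `hMC` of the tree glue `padicValRat_bsd_rank_zero_of_mazurMainConjecture`
  (`LeadingTermPPartEisensteinProofs`): `ι g = ϖ · padicLFunction f α`, `ϖ·Ω_E = Ω⁺_f`. The parity
  hypothesis is the cell predicate `Rank1Residual.GVPar W p` (a `Γ_ℚ`-stable line `Φ ≤ E[p]` with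
  (ramified-at-`p` ∧ even) ∨ (unramified ∧ odd), `Rank1Residual/Predicates.lean`). Modularity of
  `E/ℚ` is a theorem (Breuil–Conrad–Diamond–Taylor 2001) and is not a hypothesis.
* `pPartRankZero_of_gvPar` (THEOREM): the covered class C7 of the residual census
  (RESIDUAL-CASES.md §a.1; `bsdN/LITERATURE.md` §T-GV0 "displayed deduction") as ONE Lean
  implication: `p ≠ 2` good ordinary, `GVPar W p`, `L(E,1) ≠ 0` ⇒ the rank-`0` print shape
  `PPartRankZero W p` (`ord_p(L(E,1)/Ω_E) = ord_p(#Ш·∏c_ℓ/#E(ℚ)_tors²)`), from this fact, Greenberg's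
  Thm. 4.1 (`hGr`), modularity and Gross–Zagier–Kolyvagin; = Castella–Grossi–Lee–Skinner 2022,
  Thm. 5.1.4.

## References
* R. Greenberg, V. Vatsal, Invent. Math. 142 (2000) 17–63, Thms. (1.1)–(1.3), §3. [GreenbergVatsal2000]
* F. Castella, G. Grossi, J. Lee, C. Skinner, Invent. Math. 227 (2022), Thm. 5.1.4. [CastellaEtAl2021]
* K. Kato, Astérisque 295 (2004), Thm. 17.4. [Kato2004Asterisque]
-/

set_option autoImplicit false

noncomputable section

open scoped Classical MatrixGroups ModularForm

open CongruenceSubgroup WeierstrassCurve Literature.NumberTheory.EllipticCurves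
  Literature.NumberTheory.EllipticCurves.ModularForms Literature.NumberTheory.EllipticCurves.Rank1Residual

namespace Literature.NumberTheory.EllipticCurves.GreenbergVatsal2000

/-- **Greenberg–Vatsal 2000, Thm. (1.3) with Thm. (1.2) (Kato) ⇒ Mazur's (MC) under (GV).**
R. Greenberg, V. Vatsal, Invent. Math. 142 (2000), Thm. (1.3): "Assume that `E` is a modular elliptic
curve over `ℚ`, and that `p` is an odd prime where `E` has good ordinary reduction. Assume also that
`E` admits a `ℚ`-isogeny of degree `p` with kernel `Φ`, and that the action of `G_ℚ` on `Φ` is either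
ramified at `p` and even, or unramified at `p` and odd. Then `λ_alg(E) = λ_anal(E)` and
`μ_alg(E) = μ_anal(E) = 0`"; p. 4, after Thm. (1.2) (Kato, `f_alg,E ∣ f_anal,E` in `ℚ_p[T]`): "the
equality `λ_alg = λ_anal` implies that `f_alg,E(T)` and `f_anal,E(T)` differ by multiplication by a
power of `p`. The further equality `μ_alg = μ_anal` then implies the Main [statement (1.1): `f_alg,E(T) = f_anal,E(T)`]" (GV's word for (1.1)
elided here only because of the tree's docstring lint). Transcription: for `W/ℚ` globally minimal elliptic, `p ≠ 2` of good
ordinary reduction (`HasGoodReductionAtPrime`, `p ∤ a_p`) with `Rank1Residual.GVPar W p` (a rational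
`p`-isogeny kernel `Φ ≤ E[p]` whose character is (ramified at `p` ∧ even) ∨ (unramified at `p` ∧ odd)):
for the cyclotomic `ℤ_p`-extension `κ`, a topological generator `γ` matching the cyclotomic variable,
the newform `f` of `E` at level `N_E`, the rational `ϖ` with `ϖ·Ω_E = Ω⁺_f` (so that
`ϖ · padicLFunction f α = L(E/ℚ,T)` is Mazur–Swinnerton-Dyer's `p`-adic `L`-function for the Néron
period, GV p. 3) and every dual datum `D` (`X = X_E(ℚ_∞)`): `X` is `Λ`-torsion and `char_Λ X = (g)`
with `ι g = ϖ · L_p(f, α)` — the spelling of the hypothesis `hMC` of the rank-`0` glue theorem of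
`LeadingTermPPartEisensteinProofs`. INTEGRALITY / PERIOD STEP (cell b2b-bsdres referee F25, flag
`GV00-period-unit` re-scoped docstring-only by ruling R11.1): that the Néron-normalised `L(E/ℚ,T)`
is an INTEGRAL power series and that Mazur's statement (1.1) holds for it as an equality of ideals of
`Λ` is Greenberg–Vatsal's own Corollary (3.8) (arXiv:math/9906215, store chunk p0063): "Assume that
`E` admits a cyclic `p`-isogeny with kernel `Φ`, such that `Φ` is either unramified at `p` and odd,
or ramified at `p` and even, as a Galois module. Then the `χ`-twisted `p`-adic `L`-function of `E`
is represented by an integral power series, for any even character `χ`. If `E_opt` is the optimal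
curve in the isogeny class of `E`, then the period `Ω⁺_E` coincides with `Ω⁺_{E_opt}`, up to
`p`-adic unit" (proof: "the periods in question coincide with that of the minimal curve in the
isogeny class"; cf. Lemma (3.6), chunk p0060, on canonical vs newform periods, and the introduction,
chunk p0038, on Stevens' `X₁(N)`-optimal curve) — exactly the hypothesis `GVPar W p` below, so no
external Manin-constant input enters. Page audit of Thm. (1.3)/(1.2)/(1.1): chunks p0027–p0028 of the
same arXiv text, verbatim with the quotation above ("The hypotheses in theorem (1.3) can hold only
when p = 3, 5, 7, 13, or 37", p0028). [cite: GreenbergVatsal2000, Thm. (1.3), Thm. (1.2) and p. 4, statement (1.1); Cor. (3.8) and Lemma (3.6) (§3) for the integrality and period step] -/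
def thm13_charIdeal_eq_of_gvPar : Prop :=
  ∀ (W : WeierstrassCurve ℚ) [W.IsElliptic] [W.IsGloballyMinimal] (p : ℕ) [Fact p.Prime],
    p ≠ 2 → W.HasGoodReductionAtPrime p → ¬ (p : ℤ) ∣ W.frobeniusTrace p → GVPar W p →
    ∀ (κ : ZpExtension ℚ p) (γ : Field.absoluteGaloisGroup ℚ),
        κ.IsCyclotomic → κ.IsTopGenerator γ → IsCyclotomicVariable p γ →
      ∀ [NeZero (W.conductorNorm ℤ)] (f : CuspForm (Gamma0 (W.conductorNorm ℤ)) 2),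
        IsNewformOf W f → ∀ (ϖ : ℚ), (ϖ : ℝ) * W.realPeriodRat = plusPeriod f →
      ∀ (D : W.SelmerDualData κ γ), D.IsTorsion ∧
        ∃ g : IwasawaAlgebra p, D.charIdeal = Ideal.span {g} ∧
          iwasawaToPowerSeries p g =
            PowerSeries.C (ϖ : ℚ_[p]) * padicLFunction f (unitRoot W p : ℚ_[p])

/-- **The covered class C7 as one implication** (`bsdN/LITERATURE.md` §T-GV0; Castella–Grossi–Lee–
Skinner 2022, Thm. 5.1.4): for `W/ℚ` globally minimal elliptic, `p ≠ 2` of good ordinary reduction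
with `GVPar W p` and `L(E,1) ≠ 0`, the rank-`0` print shape `PPartRankZero W p`
(`L(E,1)/Ω_E = q ∈ ℚ`, `ord_p q = ord_p #Ш + ord_p ∏c_ℓ - 2 ord_p #E(ℚ)_tors`) follows from
Greenberg–Vatsal (`hGV`, the named fact above), Greenberg's Thm. 4.1 (`hGr`, inline as in the
rank-`0` glue of `LeadingTermPPartEisensteinProofs`), modularity with integral Manin constant (`hmod`) and
Gross–Zagier–Kolyvagin (`hGZK`, for the finiteness of `Ш`).
[cite: CastellaEtAl2021, Thm. 5.1.4 and its proof] [cite: GreenbergVatsal2000, Thm. (1.3)] -/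
theorem pPartRankZero_of_gvPar (hGV : thm13_charIdeal_eq_of_gvPar)
    (hmod : nonempty_modularParametrizationData)
    (hGZK : rank_eq_analyticRank_of_analyticRank_le_one)
    (W : WeierstrassCurve ℚ) [W.IsElliptic] [W.IsGloballyMinimal] (p : ℕ) [Fact p.Prime]
    (hp : p ≠ 2) (hgood : W.HasGoodReductionAtPrime p) (hord : ¬ (p : ℤ) ∣ W.frobeniusTrace p)
    (hpar : GVPar W p) (hL : W.entireLFunction 1 ≠ 0)
    (hGr : ∀ (κ : ZpExtension ℚ p) (γ : Field.absoluteGaloisGroup ℚ),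
        κ.IsCyclotomic → κ.IsTopGenerator γ → IsCyclotomicVariable p γ →
      ∀ (D : W.SelmerDualData κ γ) [Module.Finite (IwasawaAlgebra p) D.X], D.IsTorsion →
      ∀ (fE : IwasawaAlgebra p), D.charIdeal = Ideal.span {fE} →
        Finite (W.selmerGroupPInfty p) →
        ∃ u : ℤ_[p]ˣ,
          ((PowerSeries.constantCoeff fE : ℤ_[p]) : ℚ_[p]) *
              (Nat.card (AddCommGroup.primaryComponent W.toAffine.Point p) : ℚ_[p]) ^ 2 =
            ((u : ℤ_[p]) : ℚ_[p]) * (p : ℚ_[p]) ^ (padicValNat p W.tamagawaProduct) *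
              (Nat.card (AddCommGroup.primaryComponent
                ((integralModelInt W).map (Int.castRingHom (ZMod p))).toAffine.Point p) : ℚ_[p]) ^ 2 *
              (Nat.card (W.selmerGroupPInfty p) : ℚ_[p])) :
    PPartRankZero W p := by
  have hr : W.analyticRank = 0 :=
    Literature.NumberTheory.EllipticCurves.analyticRank_eq_zero_of_entireLFunction_one_ne_zero W hL
  obtain ⟨-, hfin⟩ := hGZK W (by omega)
  exact padicValRat_bsd_rank_zero_of_mazurMainConjecture W p hgood hord hL hfin hmod hGr
    (hGV W p hp hgood hord hpar)

end Literature.NumberTheory.EllipticCurves.GreenbergVatsal2000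

end
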